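import Summits.ResolutionOfSingularities.ResolutionOfSingularities.Theorems.MarkedTransferCampaignW46WWalkNRRoot
import Literature.RingTheory.CompleteLocalRings.CoefficientFieldCharP
import HarnessLib

/-!
# [OURS · L1 W4.6 rung (iii-2), NON-RATIONAL W-WALK over an ARBITRARY ground field, brick 15] THE ROOT `w`-ANCHOR AT AN ARBITRARY CLOSED
# SINGULAR POINT over ANY ground field: Cohen coordinates over a Cohen coefficient field of the completion

Cell `res-hironaka`, LADDER-RESOLUTION rung L (D-0089), slot W4.6 rung (iii); seat res-L1-s46-pv-6 (gen 8). Host route MarkedTransfer,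
`--supports stmt-ResolutionOfSingularities-16155 --as helper`; kind proof (no definition). IMPERFECT-`K` ROAD (res-L1-s46-pv-5's
`W-WALK-PLAN.md` §7.2 (c)): brick 5 (`…WWalkNRRoot`) built the coefficient field of `𝒪̂_{Z,ξ}` over a PERFECT `K` as `K(θ)` (primitive element +
Hensel). Over an arbitrary `K` the residue field `κ(ξ)` need not be separable over `K`; but a coefficient field of the complete local ring
`𝒪̂_{Z,ξ}` of characteristic `p` ALWAYS exists (Cohen; the tree's `Literature.RingTheory.CompleteLocalRings.exists_ringHom_comp_residue_eq_id_of_charP`),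
and that is all the `w`-walk needs (the coefficient fields along the walk are abstract fields of characteristic `p` embedded in `Ω`):
* `exists_coeffField_stalk_general` — a field `L` of characteristic `p` and `ι : L → 𝒪̂_ξ` mapping ONTO the residue field (`L = κ(𝒪̂_ξ)`, `ι`
  Cohen's section);
* `exists_cohen_coords_general` — `E : 𝒪̂_ξ ≅ L⟦t,y,z⟧` with `E(x) = t`, `E(y) = y`, `E(z) = z` for any generators `(x,y,z)` of `𝔪_ξ`;
* `exists_wAnchor_start_general` — THE ROOT `w`-ANCHOR of o1's regime `regimeMohWindowSurfaceInsep` at any singular point, any ground field.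

HONEST FRAMING. OURS; NOT a statement of H. Hironaka's manuscript [Hironaka2017]; nothing of it is used. AI-written; AI review is weaker
than expert review. No `sorry`; axioms standard. [cite: Matsumura1987, Thm. 28.3] (Cohen's coefficient fields), Thm. 29.7; [folklore].
-/

noncomputable section

set_option linter.dupNamespace false -- mandated namespace of this single-conjunct summit

open MvPowerSeries IsLocalRing Finset
open Literature.AlgebraicGeometry.Resolution
open Literature.RingTheory.MvPowerSeries.Jets (mem_maximalIdeal_iff_constantCoeff_eq_zero mem_maximalIdeal_pow_iff)

namespace Summit.ResolutionOfSingularities.ResolutionOfSingularities.Theorems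

namespace CampaignW46

namespace WWalkNR

open CategoryTheory AlgebraicGeometry TopologicalSpace
open Literature.AlgebraicGeometry.Hironaka2017.S02Preliminaries
open Literature.AlgebraicGeometry.Hironaka2017.Datum
open Scheme.IdealSheafData
open WWalk

variable {p : ℕ} [hp : Fact p.Prime] {K : Type} [Field K] [CharP K p]

/-! ## §1 A Cohen coefficient field of the completion, any ground field -/

/-- **A COEFFICIENT FIELD of `𝒪̂_{Z,ξ}` over ANY ground field** (Cohen): a field `L` of characteristic `p` and a ring map `ι : L → 𝒪̂_ξ` mapping
onto the residue field. [cite: Matsumura1987, Thm. 28.3] -/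
theorem exists_coeffField_stalk_general (A : AmbientDatum p K) (ξ : A.Z) [IsRegularLocalRing (A.Z.presheaf.stalk ξ)] :
    ∃ (L : Type) (_ : Field L) (_ : CharP L p)
      (ι : L →+* AdicCompletion (maximalIdeal (A.Z.presheaf.stalk ξ)) (A.Z.presheaf.stalk ξ)),
      ∀ c, ∃ l : L, c - ι l ∈ maximalIdeal (AdicCompletion (maximalIdeal (A.Z.presheaf.stalk ξ)) (A.Z.presheaf.stalk ξ)) := by
  classical
  haveI : IsNoetherianRing (AdicCompletion (maximalIdeal (A.Z.presheaf.stalk ξ)) (A.Z.presheaf.stalk ξ)) :=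
    isNoetherianRing_adicCompletion_maximalIdeal (A.Z.presheaf.stalk ξ)
  -- characteristic `p`: `K → Γ(Z, 𝒪) → 𝒪_{Z,ξ} → 𝒪̂_ξ` is a ring map out of a field
  haveI : CharP (AdicCompletion (maximalIdeal (A.Z.presheaf.stalk ξ)) (A.Z.presheaf.stalk ξ)) p := by
    let φ : K →+* AdicCompletion (maximalIdeal (A.Z.presheaf.stalk ξ)) (A.Z.presheaf.stalk ξ) :=
      (algebraMap (A.Z.presheaf.stalk ξ) _).comp
        ((A.Z.presheaf.germ ⊤ ξ trivial).hom.comp (A.hom.appTop.hom.comp (Scheme.ΓSpecIso (.of K)).inv.hom))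
    exact charP_of_injective_ringHom φ.injective p
  obtain ⟨σ, hσ⟩ := Literature.RingTheory.CompleteLocalRings.exists_ringHom_comp_residue_eq_id_of_charP
    (AdicCompletion (maximalIdeal (A.Z.presheaf.stalk ξ)) (A.Z.presheaf.stalk ξ)) p hp.out
  haveI : CharP (ResidueField (AdicCompletion (maximalIdeal (A.Z.presheaf.stalk ξ)) (A.Z.presheaf.stalk ξ))) p :=
    (CharP.charP_iff_prime_eq_zero hp.out).mpr (by
      rw [← map_natCast (residue (AdicCompletion (maximalIdeal (A.Z.presheaf.stalk ξ)) (A.Z.presheaf.stalk ξ))), CharP.cast_eq_zero, map_zero])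
  refine ⟨_, inferInstance, inferInstance, σ, fun c => ⟨residue _ c, ?_⟩⟩
  rw [← residue_eq_zero_iff, map_sub, hσ, sub_self]

/-! ## §3 Cohen coordinates adapted to three generators -/

/-- **Cohen coordinates adapted to `(x, y, z)`, over a coefficient field, ANY ground field.** `𝒪_{Z,ξ}` regular of embedding dimension `3`,
`(x, y, z)` generating `𝔪`: there is a field `L` of characteristic `p` (a Cohen coefficient field of the completion) and `E : 𝒪̂_ξ ≅ L⟦t,y,z⟧` with `E(x) = t`, `E(y) = y`,
`E(z) = z` (indexing `t = X (some 0)`, `y = X (some 1)`, `z = X none`). [cite: Matsumura1987, Thm. 29.7] -/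
theorem exists_cohen_coords_general (A : AmbientDatum p K) (ξ : A.Z)
    [IsRegularLocalRing (A.Z.presheaf.stalk ξ)] (h3 : (maximalIdeal (A.Z.presheaf.stalk ξ)).spanFinrank = 3)
    {x y z : A.Z.presheaf.stalk ξ} (hxyz : Ideal.span {x, y, z} = maximalIdeal (A.Z.presheaf.stalk ξ)) :
    ∃ (L : Type) (_ : Field L) (_ : CharP L p)
      (E : AdicCompletion (maximalIdeal (A.Z.presheaf.stalk ξ)) (A.Z.presheaf.stalk ξ) ≃+* MvPowerSeries (Option (Fin 2)) L),
      E (algebraMap _ _ x) = X (some 0) ∧ E (algebraMap _ _ y) = X (some 1) ∧ E (algebraMap _ _ z) = X none := by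
  classical
  set C := AdicCompletion (maximalIdeal (A.Z.presheaf.stalk ξ)) (A.Z.presheaf.stalk ξ)
  set ofR := algebraMap (A.Z.presheaf.stalk ξ) C with hofR
  haveI : IsNoetherianRing C := isNoetherianRing_adicCompletion_maximalIdeal (A.Z.presheaf.stalk ξ)
  have h𝔪C : maximalIdeal C = (maximalIdeal (A.Z.presheaf.stalk ξ)).map ofR := AdicCompletion.maximalIdeal_eq_map
  obtain ⟨L, _i1, _i2, ι, hι⟩ := exists_coeffField_stalk_general A ξ
  set v : Option (Fin 2) → A.Z.presheaf.stalk ξ := fun o => o.elim z (fun l => (![x, y] : Fin 2 → A.Z.presheaf.stalk ξ) l) with hv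
  have hgen : Ideal.span (Set.range fun o : Option (Fin 2) => ofR (v o)) = maximalIdeal C := by
    rw [h𝔪C, show Ideal.map ofR (maximalIdeal (A.Z.presheaf.stalk ξ)) = Ideal.map ofR (Ideal.span {x, y, z}) by rw [hxyz], Ideal.map_span]
    congr 1
    ext c
    simp only [Set.mem_range, Set.mem_image, Set.mem_insert_iff, Set.mem_singleton_iff]
    constructor
    · rintro ⟨o, rfl⟩
      rcases o with _ | l
      · exact ⟨z, Or.inr (Or.inr rfl), rfl⟩
      · have hl : l = 0 ∨ l = 1 := by fin_cases l <;> simp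
        rcases hl with rfl | rfl
        · exact ⟨x, Or.inl rfl, rfl⟩
        · exact ⟨y, Or.inr (Or.inl rfl), rfl⟩
    · rintro ⟨r, hr, rfl⟩
      rcases hr with rfl | rfl | rfl
      · exact ⟨some 0, rfl⟩
      · exact ⟨some 1, rfl⟩
      · exact ⟨none, rfl⟩
  have hdim : ringKrullDim C = Fintype.card (Option (Fin 2)) := by
    rw [ringKrullDim_adicCompletion]
    have h := IsRegularLocalRing.spanFinrank_maximalIdeal (R := A.Z.presheaf.stalk ξ)
    rw [h3] at h
    simp only [Fintype.card_option, Fintype.card_fin]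
    exact_mod_cast h.symm
  obtain ⟨E, hEX, -⟩ := FormalChart.exists_ringEquiv_mvPowerSeries_of_generators ι hι _ hgen hdim
  exact ⟨L, _i1, _i2, E, hEX (some 0), hEX (some 1), hEX none⟩

/-! ## §4 The root `w`-anchor of o1's regime at an arbitrary closed singular point -/

/-- **THE ROOT `w`-ANCHOR OVER AN ARBITRARY GROUND FIELD.** At a singular point of a state of o1's regime `regimeMohWindowSurfaceInsep` (a closed
point, possibly NOT residually rational), Cohen coordinates over a coefficient field `L` of the point adapted to the regime's own `(x, y, z)`
turn the generator `z^p + Σ a_i x^{d−i} y^i` into `z^p + f` with `ord f ≥ d ≥ p + 1` (brick 5's `exists_wAnchor_start_nr` with the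
perfectness of `K` dropped: the coefficient field is Cohen's, not a primitive-element lift). [OURS · L1 W4.6 rung (iii)] NOT a statement of the manuscript. [cite: Matsumura1987, Thm. 29.7] -/
theorem exists_wAnchor_start_general {A : AmbientDatum p K} {E : IdealExponent A.Z}
    (hRg : regimeMohWindowSurfaceInsep (p := p) (K := K) A E) {ξ : A.Z} (hξ : ξ ∈ E.sing) :
    ∃ (L : Type) (_ : Field L) (_ : CharP L p)
      (e : AdicCompletion (maximalIdeal (A.Z.presheaf.stalk ξ)) (A.Z.presheaf.stalk ξ) ≃+* MvPowerSeries (Option (Fin 2)) L)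
      (f₀ : A.Z.presheaf.stalk ξ) (w f : MvPowerSeries (Option (Fin 2)) L),
      stalkIdeal E.J ξ = Ideal.span {f₀} ∧ IsUnit w ∧ e (algebraMap _ _ f₀) = w * (X none ^ p + f) ∧ LowVanish (p + 1) f := by
  classical
  obtain ⟨hR, h3, -, -, -⟩ := MohWindowShadeAnchorWalk.regime_point hRg hξ
  haveI := hR
  obtain ⟨-, -, x, y, z, hxyz, d, a, hbd, -, -, hI⟩ := coeffAt_of_regime hRg hξ
  obtain ⟨L, _i1, _i2, e, hEx, hEy, hEz⟩ := exists_cohen_coords_general A ξ h3 hxyz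
  set φ : A.Z.presheaf.stalk ξ →+* MvPowerSeries (Option (Fin 2)) L :=
    (e : _ →+* MvPowerSeries (Option (Fin 2)) L).comp (algebraMap _ (AdicCompletion (maximalIdeal (A.Z.presheaf.stalk ξ)) (A.Z.presheaf.stalk ξ))) with hφ
  have hφa : ∀ r, φ r = e (algebraMap _ _ r) := fun r => rfl
  set f : MvPowerSeries (Option (Fin 2)) L := ∑ i ∈ range (d + 1), φ (a i) * X (some 0) ^ (d - i) * X (some 1) ^ i with hf
  refine ⟨L, _i1, _i2, e, z ^ p + ∑ i ∈ range (d + 1), a i * x ^ (d - i) * y ^ i, 1, f, hI, isUnit_one, ?_, ?_⟩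
  · rw [one_mul, ← hφa, map_add, map_pow, hφa z, hEz, map_sum]
    congr 1
    refine sum_congr rfl fun i _ => ?_
    rw [map_mul, map_mul, map_pow, map_pow, hφa x, hEx, hφa y, hEy]
  · refine mem_maximalIdeal_pow_iff.mp (Ideal.pow_le_pow_right (by omega : p + 1 ≤ d) (Ideal.sum_mem _ fun i hi => ?_))
    rw [mem_range] at hi
    rw [mul_assoc]
    refine Ideal.mul_mem_left _ _ ?_
    have h1 := Ideal.mul_mem_mul
      (Ideal.pow_mem_pow (mem_maximalIdeal_iff_constantCoeff_eq_zero.mpr (constantCoeff_X (some 0) : constantCoeff (X (some 0) : MvPowerSeries (Option (Fin 2)) L) = 0)) (d - i))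
      (Ideal.pow_mem_pow (mem_maximalIdeal_iff_constantCoeff_eq_zero.mpr (constantCoeff_X (some 1) : constantCoeff (X (some 1) : MvPowerSeries (Option (Fin 2)) L) = 0)) i)
    rwa [← pow_add, show d - i + i = d by omega] at h1

end WWalkNR

end CampaignW46

end Summit.ResolutionOfSingularities.ResolutionOfSingularities.Theorems

end
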